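import Literature.NumberTheory.Automorphic.HermitianLatticeTreeDefs
import Literature.NumberTheory.Automorphic.UnitaryGroupModularLocus
import Literature.NumberTheory.Automorphic.HeckeTransversalGL
import HarnessLib

/-!
# `U(H)` is transitive on the self-dual and on the `ϖ`-modular vertices of the lattice tree of a hermitian plane — the hypotheses (hA), (hB) of
# the Euler relation `#Fix(K) + #Fix(K¹) = #Fix(K ∩ K¹) + 1` in `HermitianLatticeTree` currency (Jacobowitz 1962 §7–§8; Kottwitz 1988 §2)

Topic `NumberTheory/Automorphic`; namespace `Literature.NumberTheory.Automorphic.HermitianLatticeTree`.  THEOREMS ONLY (no definition, no instance, no notation,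
no named fact, no `sorry`).  Cell `pub/hodgecm-mathlib`, F0∕P3a, (R2)-EP road ∕ (T-road): the two TRANSITIVITY binders of the elliptic Euler relation
`natCard_fixedBy_add_eq_natCard_fixedBy_inf_add_one … (hA) (hB) (hI) …` (A-p17 (g22), (T3)), reshaped from the `glInt`∕`formCongr` currency of ★ `UnitaryGroupSelfDualLocus`
(self-dual locus `= U(H)·GL₂(𝒪)`) and ★ `UnitaryGroupModularLocus` (ϖ-modular locus `= U(H)·S·GL₂(𝒪)` for a scaling similitude `S`) into the `latt`∕`IsSelfDualLattice`∕
`IsModularLattice` tokens of ★ `HermitianLatticeTreeDefs`.  HONEST LABEL: HC_CM is proved only modulo the printed citations until rung 0 closes; nothing printed is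
asserted here — elementary reshaping.

* §1 the bridge **`isUnimodular₂_iff_exists_mem_glInt`** (`IsUnimodular₂ X ↔ ∃ J′ ∈ GL₂(𝒪), ↑J′ = X`, ★ `mem_glInt_of_isIntegralMatrix` ∕ `isIntegralMatrix_of_mem_glInt` ∕
  `valuation_det_eq_one_of_mem_glInt`) and its `ϖ⁻¹ •` form **`isUnimodular₂_inv_smul_iff_exists_mem_glInt`** (`IsUnimodular₂ (ϖ⁻¹ • X) ↔ ∃ J′ ∈ GL₂(𝒪), ϖ • ↑J′ = X`);
* §2 **(hA)** `forall_isSelfDualLattice_exists_latt_eq_of_selfDualLocus` and **(hB)** `forall_isModularLattice_exists_latt_mul_eq_of_selfDualLocus` over the self-dual locus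
  statement as a HYPOTHESIS `hsd` (so every ★ specialisation transfers) and a scaling similitude `g₁` (`ᵗσ(g₁) H g₁ = ϖ • H`);
* §3 the dischargings `…_of_isUnit_sub` (non-archimedean local field, `σ` residually non-trivial) — the shape the per-place EP assembly consumes at an inert place
  (`H = (Φ₂)_w ∈ GL₂(𝒪_w)`, `g₁ = diag(1, ϖ_w)`, ★ `formCongr_glDiagonal_one_eq_smul_placeForm_antidiag`).

References: [Jacobowitz1962] §7 Thm. 7.1, §8; [Kottwitz1988] §2; [Serre1980Trees] II.1.1.
-/

set_option autoImplicit false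

noncomputable section

open scoped ValuativeRel Matrix MatrixGroups
open Matrix ValuativeRel

namespace Literature.NumberTheory.Automorphic.HermitianLatticeTree

open Literature.NumberTheory.Automorphic Literature.NumberTheory.Automorphic.UnitaryGroup

variable {E : Type*} [Field E] [ValuativeRel E] (σ : E →+* E)

/-! ## §1 `IsUnimodular₂` = «is the matrix of an element of `GL₂(𝒪)`» -/

omit σ in
/-- **`IsUnimodular₂ X ↔ X ∈ GL₂(𝒪)`** (integral entries and unit determinant ⟺ integral with integral inverse, ★ `mem_glInt_of_isIntegralMatrix`).
[cite: Jacobowitz1962, §7] -/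
theorem isUnimodular₂_iff_exists_mem_glInt (X : Matrix (Fin 2) (Fin 2) E) :
    IsUnimodular₂ X ↔ ∃ J' ∈ glInt 2 E, (J' : Matrix (Fin 2) (Fin 2) E) = X := by
  constructor
  · rintro ⟨hint, hdet⟩
    have hdet' : IsUnit X.det := by
      rw [isUnit_iff_ne_zero]
      intro h0
      rw [h0, map_zero] at hdet
      exact zero_ne_one hdet
    refine ⟨Matrix.GeneralLinearGroup.mk'' X hdet', mem_glInt_of_isIntegralMatrix (fun i j => hint i j) hdet, rfl⟩
  · rintro ⟨J', hJ', rfl⟩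
    exact ⟨fun i j => isIntegralMatrix_of_mem_glInt hJ' i j, valuation_det_eq_one_of_mem_glInt hJ'⟩

omit σ in
/-- **`IsUnimodular₂ (ϖ⁻¹ • X) ↔ X ∈ ϖ · GL₂(𝒪)`** (`ϖ ≠ 0`): the `ϖ`-modular token of ★ `HermitianLatticeTreeDefs` is the `c • ↑J′ = …` token of ★ `UnitaryGroupModularLocus`.
[cite: Jacobowitz1962, §8] -/
theorem isUnimodular₂_inv_smul_iff_exists_mem_glInt {ϖ : E} (hϖ : ϖ ≠ 0) (X : Matrix (Fin 2) (Fin 2) E) :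
    IsUnimodular₂ (ϖ⁻¹ • X) ↔ ∃ J' ∈ glInt 2 E, ϖ • (J' : Matrix (Fin 2) (Fin 2) E) = X := by
  rw [isUnimodular₂_iff_exists_mem_glInt]
  constructor
  · rintro ⟨J', hJ', h⟩
    exact ⟨J', hJ', by rw [h, smul_smul, mul_inv_cancel₀ hϖ, one_smul]⟩
  · rintro ⟨J', hJ', h⟩
    exact ⟨J', hJ', by rw [← h, smul_smul, inv_mul_cancel₀ hϖ, one_smul]⟩

/-! ## §2 (hA) and (hB) over the self-dual locus hypothesis -/

/-- **(hA) `U(H)` IS TRANSITIVE ON SELF-DUAL LATTICES**: if the self-dual locus of `GL₂(E)` is `U(H)·GL₂(𝒪)` (`hsd`, ★ `exists_mem_unitaryGroupOfForm_mul_of_selfDual`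
and its specialisations), every self-dual lattice is `latt ↑u = u·𝒪²` for some `u ∈ U(H)`. [cite: Jacobowitz1962, §7 Thm. 7.1] [cite: Kottwitz1988, §2] -/
theorem forall_isSelfDualLattice_exists_latt_eq_of_selfDualLocus (H : Matrix (Fin 2) (Fin 2) E)
    (hsd : ∀ h : GL (Fin 2) E, (∃ J' ∈ glInt 2 E, (J' : Matrix (Fin 2) (Fin 2) E) = formCongr σ h H) →
      ∃ u ∈ unitaryGroupOfForm σ H, ∃ k ∈ glInt 2 E, h = u * k) :
    ∀ M : Submodule 𝒪[E] (Fin 2 → E), IsSelfDualLattice σ H M →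
      ∃ u : ↥(unitaryGroupOfForm σ H), latt (((u : GL (Fin 2) E)) : Matrix (Fin 2) (Fin 2) E) = M := by
  rintro M ⟨g, rfl, hu⟩
  obtain ⟨u, huU, k, hk, rfl⟩ := hsd g ((isUnimodular₂_iff_exists_mem_glInt _).1 hu)
  refine ⟨⟨u, huU⟩, ?_⟩
  change Submodule.span 𝒪[E] (Set.range ((u : Matrix (Fin 2) (Fin 2) E))ᵀ) =
    Submodule.span 𝒪[E] (Set.range (((u * k : GL (Fin 2) E) : Matrix (Fin 2) (Fin 2) E))ᵀ)
  rw [span_range_transpose_eq_iff, inv_mul_cancel_left]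
  exact hk

/-- **(hB) `U(H)` IS TRANSITIVE ON `ϖ`-MODULAR LATTICES** through the reference vertex `latt ↑g₁ = g₁·𝒪²` of a scaling similitude `g₁` (`ᵗσ(g₁) H g₁ = ϖ • H`, `ϖ ≠ 0`):
under `hsd`, every `ϖ`-modular lattice is `latt ↑(u g₁)` for some `u ∈ U(H)` (★ `exists_mem_unitaryGroupOfForm_span_eq_of_modular_of_selfDualLocus`).
[cite: Jacobowitz1962, §8] [cite: Kottwitz1988, §2] -/
theorem forall_isModularLattice_exists_latt_mul_eq_of_selfDualLocus (H : Matrix (Fin 2) (Fin 2) E) {ϖ : E} (hϖ : ϖ ≠ 0)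
    (g₁ : GL (Fin 2) E) (hg₁ : formCongr σ g₁ H = ϖ • H)
    (hsd : ∀ h : GL (Fin 2) E, (∃ J' ∈ glInt 2 E, (J' : Matrix (Fin 2) (Fin 2) E) = formCongr σ h H) →
      ∃ u ∈ unitaryGroupOfForm σ H, ∃ k ∈ glInt 2 E, h = u * k) :
    ∀ M : Submodule 𝒪[E] (Fin 2 → E), IsModularLattice σ ϖ H M →
      ∃ u : ↥(unitaryGroupOfForm σ H), latt (((u : GL (Fin 2) E) * g₁ : GL (Fin 2) E) : Matrix (Fin 2) (Fin 2) E) = M := by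
  rintro M ⟨g, rfl, hu⟩
  obtain ⟨u, huU, hΛ⟩ := exists_mem_unitaryGroupOfForm_span_eq_of_modular_of_selfDualLocus σ H hϖ g₁ hg₁ hsd g
    ((isUnimodular₂_inv_smul_iff_exists_mem_glInt hϖ _).1 hu)
  exact ⟨⟨u, huU⟩, hΛ.symm⟩

/-- **The reference vertex `latt ↑g₁` of a scaling similitude IS `ϖ`-modular** when `H ∈ GL₂(𝒪)` (`ϖ⁻¹ • ᵗσ(g₁) H g₁ = H`). [cite: Jacobowitz1962, §8] -/
theorem isModularLattice_latt_of_formCongr_eq_smul (H : GL (Fin 2) E) (hH : H ∈ glInt 2 E) {ϖ : E} (hϖ : ϖ ≠ 0)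
    (g₁ : GL (Fin 2) E) (hg₁ : formCongr σ g₁ (H : Matrix (Fin 2) (Fin 2) E) = ϖ • (H : Matrix (Fin 2) (Fin 2) E)) :
    IsModularLattice σ ϖ (H : Matrix (Fin 2) (Fin 2) E) (latt (g₁ : Matrix (Fin 2) (Fin 2) E)) :=
  ⟨g₁, rfl, (isUnimodular₂_inv_smul_iff_exists_mem_glInt hϖ _).2 ⟨H, hH, hg₁.symm⟩⟩

/-- **The root `latt 1 = 𝒪²` IS self-dual** when `H ∈ GL₂(𝒪)`. [cite: Jacobowitz1962, §7] -/
theorem isSelfDualLattice_latt_one_of_mem_glInt (H : GL (Fin 2) E) (hH : H ∈ glInt 2 E) :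
    IsSelfDualLattice σ (H : Matrix (Fin 2) (Fin 2) E) (latt ((1 : GL (Fin 2) E) : Matrix (Fin 2) (Fin 2) E)) := by
  refine ⟨1, rfl, (isUnimodular₂_iff_exists_mem_glInt _).2 ⟨H, hH, ?_⟩⟩
  simp only [formCongr, Units.val_one, Matrix.map_one σ (map_zero σ) (map_one σ), Matrix.transpose_one, Matrix.one_mul, Matrix.mul_one]

/-! ## §3 Over a non-archimedean local field (`σ` residually non-trivial): (hA), (hB) discharged -/

section LocalField

variable {F : Type*} [Field F] [ValuativeRel F] [UniformSpace F] [IsUniformAddGroup F] [IsNonarchimedeanLocalField F] (τ : F →+* F)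

/-- **(hA) discharged**: `F` a non-archimedean local field, `τ` an involution preserving `𝒪` with `τ a − a` a unit for some `a ∈ 𝒪`, `H ∈ GL₂(𝒪)` `τ`-hermitian —
every self-dual lattice is `u·𝒪²`, `u ∈ U(H)`. [cite: Jacobowitz1962, §7 Thm. 7.1] [cite: Kottwitz1988, §2] -/
theorem forall_isSelfDualLattice_exists_latt_eq_of_isUnit_sub (hττ : ∀ x, τ (τ x) = x) (hτO : ∀ x : 𝒪[F], τ x ∈ 𝒪[F])
    (a : 𝒪[F]) (ha : IsUnit ((⟨τ a, hτO a⟩ : 𝒪[F]) - a))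
    (H : GL (Fin 2) F) (hH : H ∈ glInt 2 F) (hHh : ((H : Matrix (Fin 2) (Fin 2) F).map τ)ᵀ = H) :
    ∀ M : Submodule 𝒪[F] (Fin 2 → F), IsSelfDualLattice τ (H : Matrix (Fin 2) (Fin 2) F) M →
      ∃ u : ↥(unitaryGroupOfForm τ (H : Matrix (Fin 2) (Fin 2) F)), latt (((u : GL (Fin 2) F)) : Matrix (Fin 2) (Fin 2) F) = M :=
  forall_isSelfDualLattice_exists_latt_eq_of_selfDualLocus τ (H : Matrix (Fin 2) (Fin 2) F)
    (exists_mem_unitaryGroupOfForm_mul_of_selfDual_of_isUnit_sub τ hττ hτO a ha H hH hHh)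

/-- **(hB) discharged**: under the same hypotheses and a scaling similitude `g₁` (`ᵗτ(g₁) H g₁ = ϖ • H`, `ϖ ≠ 0`), every `ϖ`-modular lattice is `u·g₁·𝒪²`,
`u ∈ U(H)`. [cite: Jacobowitz1962, §8] [cite: Kottwitz1988, §2] -/
theorem forall_isModularLattice_exists_latt_mul_eq_of_isUnit_sub (hττ : ∀ x, τ (τ x) = x) (hτO : ∀ x : 𝒪[F], τ x ∈ 𝒪[F])
    (a : 𝒪[F]) (ha : IsUnit ((⟨τ a, hτO a⟩ : 𝒪[F]) - a))
    (H : GL (Fin 2) F) (hH : H ∈ glInt 2 F) (hHh : ((H : Matrix (Fin 2) (Fin 2) F).map τ)ᵀ = H) {ϖ : F} (hϖ : ϖ ≠ 0)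
    (g₁ : GL (Fin 2) F) (hg₁ : formCongr τ g₁ (H : Matrix (Fin 2) (Fin 2) F) = ϖ • (H : Matrix (Fin 2) (Fin 2) F)) :
    ∀ M : Submodule 𝒪[F] (Fin 2 → F), IsModularLattice τ ϖ (H : Matrix (Fin 2) (Fin 2) F) M →
      ∃ u : ↥(unitaryGroupOfForm τ (H : Matrix (Fin 2) (Fin 2) F)),
        latt (((u : GL (Fin 2) F) * g₁ : GL (Fin 2) F) : Matrix (Fin 2) (Fin 2) F) = M :=
  forall_isModularLattice_exists_latt_mul_eq_of_selfDualLocus τ (H : Matrix (Fin 2) (Fin 2) F) hϖ g₁ hg₁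
    (exists_mem_unitaryGroupOfForm_mul_of_selfDual_of_isUnit_sub τ hττ hτO a ha H hH hHh)

end LocalField

end Literature.NumberTheory.Automorphic.HermitianLatticeTree
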